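import Literature.MathematicalPhysics.KineticTheory.IllnerPulvirentiTransportDispersive
import Literature.Analysis.FluidPDE.LiouvilleBBGKY
import Literature.Analysis.FluidPDE.HardSphereDynamicsProofs
import HarnessLib

/-!
# The hard-sphere transport with canonical boundary values carries the dispersive weight
# (CIP 1994 §4.5 (5.3) with Lemma 4.2.4, at pre-collisional configurations)

Topic: MathematicalPhysics / KineticTheory. A brick of the BBGKY side of the named fact
`Literature.MathematicalPhysics.KineticTheory.illner_pulvirenti` (Cercignani–Illner–Pulvirenti 1994
Thm 4.5.1; Illner–Pulvirenti 1986/1989), on `ℝ^d`.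

The Duhamel series of the BBGKY hierarchy of hard spheres (CIP 1994 (4.7), (4.3.10)) evaluates
the transported functions `S^σ(t) P = P ∘ T^{-t}` at the *pre-collisional* (incoming) contact
configurations produced by the collision operator `Q^σ_{s+1}` — the loss configuration
`(Z_s, x_i - σn, ξ_{s+1})` and the gain configuration `(…, x_i, ξ_i', …, x_i + σn, ξ'_{s+1})` of
(4.3.9) are both incoming — where the honest hard-sphere flow of the tree
(`Literature.Analysis.FluidPDE.HardSphereFlow`: right-continuous trajectories, an a.e. good set) is NOT
defined: an incoming contact configuration is the left limit of a trajectory at a collision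
instant, never its value (`LiouvilleBBGKY`: `gainConfig_not_mem_good`, `lossConfig_not_mem_good`).
The printed proofs identify pre- and post-collisional values, "`P(z) = P(z')` if `x_i - x_j = σn`"
(CIP (4.3.4)); the tree builds this identification into the *canonical boundary version*
`Literature.Analysis.FluidPDE.incomingLift` / `boundaryLift` (at an incoming contact configuration of a
pair `(i, s+1)` read the function at the outgoing partner `collidePair`), as in the physical
hierarchy `Literature.Analysis.FluidPDE.MildBBGKYae`. Accordingly the transports of the honest BBGKY
Duhamel series along hard-sphere flows `Φ` are
`T_m(t) g = boundaryLift G ε m (1_{good} · g ∘ Φ^m_{-t})` (the good-set restriction as in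
`gcEvolved`), and the global estimate of CIP Thm 4.5.1, Step 3, needs hypothesis `htr` of the
abstract chain estimate `abs_duhamelChain_le_dispersive_of_le` (`IllnerPulvirentiChainEstimate`) for
THESE transports: they must carry the dispersive weight `e^{-β₀ ∑_k |x_k - τ v_k|²}` from time `τ` to
time `t`. At a pre-collisional configuration `Z` this is the dispersion inequality of CIP Lemma
4.2.4 applied from the LEFT LIMIT of the trajectory through the outgoing partner `Z'` (whose left
limit at the collision instant is `Z` itself), and the bookkeeping only closes if the weight
remembers, at a post-collisional contact configuration, the (smaller) weight of its incoming
partner: `∑_k |x_k - t v_k|²` jumps DOWN by `2tσ|n · (ξ_i - ξ_j)|` across a collision read forward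
(`sum_norm_sq_add_smul_collidePair`, `HardSphereDispersion`). This file therefore introduces the
*lifted dispersive weight* and PROVES `htr` for it:

* `contactPairs ε W`, `bffMoment τ W = ∑_k |x_k - τ v_k|²`, `liftedMoment ε τ W` (the maximum of
  `bffMoment τ` over `W` and its reflections `collidePair i j W` in the contact pairs of `W`) and
  `liftedWeight ε β₀ τ m W = e^{-β₀ liftedMoment}` if `W` has at most one contact pair, `0` if it has
  two or more (such configurations lie on no hard-sphere trajectory: collisions are binary) (§1);
  `liftedWeight ≤ e^{-β₀ bffMoment}`, and at `τ = 0` the lifted and plain moments agree.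
* `IsHardSphereTrajectory.card_contactPairs_le_one`, `HardSphereFlow.card_contactPairs_le_one_of_mem_good`
  (§2): a value of a hard-sphere trajectory, in particular a good configuration, has at most one
  contact pair (`IsHardSphereTrajectory.binary`).
* `IsHardSphereTrajectory.bffMoment_leftLim_le` (§2): **the dispersion inequality from the left
  limit**, `∑_k |x_k(γ(t⁻)) - t v_k(γ(t⁻))|² ≤ ∑_k |x_k(γ τ) - τ v_k(γ τ)|²` for `0 ≤ τ < t`
  (CIP Lemma 4.2.4 up to a time `u ∈ [τ, t)` after the last collision before `t`, then free flight).
* `abs_boundaryLift_indicator_hsTransport_le_liftedWeight` (§3): **`htr` for the lifted good-set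
  transport** — if `|g(Y)| ≤ K · liftedWeight_τ(Y) e^{-b E(Y)}` at every `Y` with at most one contact
  pair, then `|T_m(t - τ) g (Z)| ≤ K · liftedWeight_t(Z) e^{-b E(Z)}` at EVERY `Z` (`0 ≤ τ ≤ t`);
  with the two input forms actually used by the chain: the lifted form itself
  (`…_of_liftedWeight`) and, at `τ = 0`, the plain position Gaussian `K e^{-β₀ ∑|x_k|²} e^{-b E}` of
  the initial data (`…_of_sq_norm`), for which no lifting is needed since positions do not jump.

Definitions with bodies and theorems; no named fact. The single-step estimate of the collision
operator for the lifted weight, the chain bound and the majorants of the grand-canonical Duhamel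
terms are the sequel `IllnerPulvirentiGCSeriesBounds`.

## References

* C. Cercignani, R. Illner, M. Pulvirenti, *The Mathematical Theory of Dilute Gases*, Applied
  Mathematical Sciences 106, Springer (1994), §4.2 Lemma 4.2.3–4.2.4 (p. 67), §4.3 (4.3.4),
  (4.3.9)–(4.3.10) (pp. 74–76), §4.5 (5.2)–(5.3) (p. 89) (held:
  `lit read book:cercignani1994-mathematical-theory-dilute-gases`; bib key `CIP1994`).
* R. Illner, M. Pulvirenti, Comm. Math. Phys. 105 (1986) 189–203, §2; 121 (1989) 143–146.
* H. Spohn, *On the integrated form of the BBGKY hierarchy for hard spheres*,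
  arXiv:math-ph/0605068, (8) (continuity along trajectories at the collision surfaces).
-/

open MeasureTheory Metric Real Set Filter Topology Function
open scoped InnerProductSpace

namespace Literature.MathematicalPhysics.KineticTheory

noncomputable section

open Literature.Analysis.FluidPDE

variable {d : Type*} [Fintype d]

/-! ## §1. Contact pairs, the backward-free-flight moment and the lifted dispersive weight -/

section Weight

variable {m : ℕ}

open scoped Classical in
/-- The contact pairs of a configuration of hard spheres of diameter `ε` in `ℝ^d`: the ordered
pairs `i < j` with `|x_i - x_j| = ε` (CIP 1994 §4.2: the boundary `∂Λ` of the phase space is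
the union of the sets `|x_i - x_j| = σ`). [cite: CIP1994, §4.2] -/
def contactPairs (ε : ℝ) (W : Config m d (EuclideanSpace ℝ d)) : Finset (Fin m × Fin m) :=
  Finset.univ.filter fun p => p.1 < p.2 ∧ ‖(W p.1).1 - (W p.2).1‖ = ε

/-- The backward-free-flight moment of inertia `I_τ(W) = ∑_k |x_k - τ v_k|²` — the exponent of the
dispersive weight `e^{-β₀ I(T_0^{-τ} z)}` of CIP 1994 (5.3). [cite: CIP1994, §4.5 (5.3)] -/
def bffMoment (τ : ℝ) (W : Config m d (EuclideanSpace ℝ d)) : ℝ :=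
  ∑ k, ‖(W k).1 - τ • (W k).2‖ ^ 2

/-- The *lifted* backward-free-flight moment: the maximum of `I_τ` over the configuration and its
elastic reflections `collidePair i j W` in its contact pairs — at a post-collisional contact
configuration this is the moment of the pre-collisional partner (CIP 1994 (4.3.4): the two are
identified), which is the larger one (`sum_norm_sq_add_smul_collidePair`).
[cite: CIP1994, §4.3 (4.3.4)] -/
def liftedMoment (ε τ : ℝ) (W : Config m d (EuclideanSpace ℝ d)) : ℝ :=
  (contactPairs ε W).fold max (bffMoment τ W)
    fun p => bffMoment τ (collidePair (Euclidean.geometry d) p.1 p.2 W)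

/-- The *lifted dispersive weight* `D_τ(W)`: `e^{-β₀ liftedMoment ε τ W}` if `W` has at most one
contact pair, and `0` if it has two or more (no hard-sphere trajectory passes through such a
configuration, collisions being binary, CIP 1994 Thm 4.2.1 / Def. of `Γ*`). This is the weight
carried by the Duhamel chains of the BBGKY hierarchy with canonical boundary values
(`abs_boundaryLift_indicator_hsTransport_le_liftedWeight`); it is dominated by the plain weight
`e^{-β₀ I_τ(W)}` of CIP (5.3) (`liftedWeight_le_exp`). [cite: CIP1994, §4.5 (5.3)] -/
def liftedWeight (ε β₀ τ : ℝ) (m : ℕ) (W : Config m d (EuclideanSpace ℝ d)) : ℝ :=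
  if 2 ≤ (contactPairs ε W).card then 0 else exp (-β₀ * liftedMoment ε τ W)

/-- Membership in the set of contact pairs. [folklore] -/
theorem mem_contactPairs {ε : ℝ} {W : Config m d (EuclideanSpace ℝ d)} {p : Fin m × Fin m} :
    p ∈ contactPairs ε W ↔ p.1 < p.2 ∧ ‖(W p.1).1 - (W p.2).1‖ = ε := by
  classical
  simp [contactPairs]

/-- The contact pairs only depend on the positions. [folklore] -/
theorem contactPairs_congr {ε : ℝ} {W W' : Config m d (EuclideanSpace ℝ d)}
    (h : ∀ k, (W k).1 = (W' k).1) : contactPairs ε W = contactPairs ε W' := by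
  ext p
  simp only [mem_contactPairs, h]

/-- An elastic reflection does not change the contact pairs (positions are unchanged). [folklore] -/
@[simp]
theorem contactPairs_collidePair {ε : ℝ} (i j : Fin m) (W : Config m d (EuclideanSpace ℝ d)) :
    contactPairs ε (collidePair (Euclidean.geometry d) i j W) = contactPairs ε W :=
  contactPairs_congr fun k => collidePair_apply_fst W k

/-- The backward-free-flight moment is nonnegative. [folklore] -/
theorem bffMoment_nonneg (τ : ℝ) (W : Config m d (EuclideanSpace ℝ d)) : 0 ≤ bffMoment τ W :=
  Finset.sum_nonneg fun k _ => by positivity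

/-- At `τ = 0` the moment is the moment of inertia `∑ |x_k|²`. [folklore] -/
theorem bffMoment_zero (W : Config m d (EuclideanSpace ℝ d)) : bffMoment 0 W = ∑ k, ‖(W k).1‖ ^ 2 := by
  simp [bffMoment]

/-- At `τ = 0` the moment is blind to elastic reflections. [folklore] -/
theorem bffMoment_zero_collidePair (i j : Fin m) (W : Config m d (EuclideanSpace ℝ d)) :
    bffMoment 0 (collidePair (Euclidean.geometry d) i j W) = bffMoment 0 W := by
  simp [bffMoment_zero]

/-- Free flight by `r` turns `I_t` into `I_{t-r}`: `∑ |x_k + r v_k - t v_k|² = ∑ |x_k - (t - r) v_k|²`.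
[folklore] -/
theorem bffMoment_freeFlight (t r : ℝ) (W : Config m d (EuclideanSpace ℝ d)) :
    bffMoment t (freeFlight (Euclidean.geometry d) r W) = bffMoment (t - r) W := by
  unfold bffMoment
  refine Finset.sum_congr rfl fun k _ => ?_
  simp only [freeFlight_apply, Euclidean.geometry_translate]
  congr 2
  rw [sub_smul]
  abel

/-- The plain moment is at most the lifted one. [folklore] -/
theorem bffMoment_le_liftedMoment (ε τ : ℝ) (W : Config m d (EuclideanSpace ℝ d)) :
    bffMoment τ W ≤ liftedMoment ε τ W :=
  (Finset.le_fold_max _).2 (Or.inl le_rfl)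

/-- The moment of the reflection in a contact pair is at most the lifted moment. [folklore] -/
theorem bffMoment_collidePair_le_liftedMoment {ε : ℝ} (τ : ℝ) {W : Config m d (EuclideanSpace ℝ d)}
    {p : Fin m × Fin m} (hp : p ∈ contactPairs ε W) :
    bffMoment τ (collidePair (Euclidean.geometry d) p.1 p.2 W) ≤ liftedMoment ε τ W :=
  (Finset.le_fold_max _).2 (Or.inr ⟨p, hp, le_rfl⟩)

/-- The lifted moment is below `c` iff the moments of `W` and of all its contact reflections are.
[folklore] -/
theorem liftedMoment_le_iff {ε τ c : ℝ} {W : Config m d (EuclideanSpace ℝ d)} :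
    liftedMoment ε τ W ≤ c ↔ bffMoment τ W ≤ c ∧
      ∀ p ∈ contactPairs ε W, bffMoment τ (collidePair (Euclidean.geometry d) p.1 p.2 W) ≤ c :=
  Finset.fold_max_le _

/-- At `τ = 0` the lifted moment is the plain one (reflections do not move particles). [folklore] -/
theorem liftedMoment_zero (ε : ℝ) (W : Config m d (EuclideanSpace ℝ d)) :
    liftedMoment ε 0 W = bffMoment 0 W :=
  le_antisymm (liftedMoment_le_iff.2 ⟨le_rfl, fun p _ => (bffMoment_zero_collidePair p.1 p.2 W).le⟩)
    (bffMoment_le_liftedMoment ε 0 W)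

/-- The lifted weight is nonnegative. [folklore] -/
theorem liftedWeight_nonneg (ε β₀ τ : ℝ) (m : ℕ) (W : Config m d (EuclideanSpace ℝ d)) :
    0 ≤ liftedWeight ε β₀ τ m W := by
  unfold liftedWeight
  split_ifs
  · exact le_rfl
  · exact (exp_pos _).le

/-- With two or more contact pairs the lifted weight vanishes. [folklore] -/
theorem liftedWeight_of_two_le {ε : ℝ} (β₀ τ : ℝ) {W : Config m d (EuclideanSpace ℝ d)}
    (h : 2 ≤ (contactPairs ε W).card) : liftedWeight ε β₀ τ m W = 0 := by
  simp [liftedWeight, h]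

/-- With at most one contact pair the lifted weight is `e^{-β₀ liftedMoment}`. [folklore] -/
theorem liftedWeight_of_card_le_one {ε : ℝ} (β₀ τ : ℝ) {W : Config m d (EuclideanSpace ℝ d)}
    (h : (contactPairs ε W).card ≤ 1) :
    liftedWeight ε β₀ τ m W = exp (-β₀ * liftedMoment ε τ W) := by
  simp [liftedWeight, show ¬ 2 ≤ (contactPairs ε W).card by omega]

/-- **The lifted weight is dominated by the plain dispersive weight** `e^{-β₀ ∑ |x_k - τ v_k|²}` of
CIP 1994 (5.3) (`β₀ ≥ 0`). [cite: CIP1994, §4.5 (5.3)] -/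
theorem liftedWeight_le_exp {ε β₀ : ℝ} (hβ₀ : 0 ≤ β₀) (τ : ℝ) (m : ℕ)
    (W : Config m d (EuclideanSpace ℝ d)) :
    liftedWeight ε β₀ τ m W ≤ exp (-β₀ * bffMoment τ W) := by
  unfold liftedWeight
  split_ifs
  · exact (exp_pos _).le
  · exact exp_le_exp.2 (mul_le_mul_of_nonpos_left (bffMoment_le_liftedMoment ε τ W) (by linarith))

/-- The lifted weight is at most `1` (`β₀ ≥ 0`). [folklore] -/
theorem liftedWeight_le_one {ε β₀ : ℝ} (hβ₀ : 0 ≤ β₀) (τ : ℝ) (m : ℕ)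
    (W : Config m d (EuclideanSpace ℝ d)) : liftedWeight ε β₀ τ m W ≤ 1 :=
  (liftedWeight_le_exp hβ₀ τ m W).trans (exp_le_one_iff.2
    (mul_nonpos_of_nonpos_of_nonneg (by linarith) (bffMoment_nonneg τ W)))

/-- At `τ = 0`, on configurations with at most one contact pair, the lifted weight is the position
Gaussian `e^{-β₀ ∑ |x_k|²}` of the initial data. [folklore] -/
theorem liftedWeight_zero_of_card_le_one {ε : ℝ} (β₀ : ℝ) {W : Config m d (EuclideanSpace ℝ d)}
    (h : (contactPairs ε W).card ≤ 1) :
    liftedWeight ε β₀ 0 m W = exp (-β₀ * ∑ k, ‖(W k).1‖ ^ 2) := by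
  rw [liftedWeight_of_card_le_one β₀ 0 h, liftedMoment_zero, bffMoment_zero]

/-- The lifted weight of a configuration with at most one contact pair is unchanged by the
reflection in that pair: both are `e^{-β₀ max (I_τ W, I_τ W')}` (the involution `collidePair`
exchanges the two moments). [folklore] -/
theorem liftedWeight_collidePair_of_mem {ε : ℝ} (β₀ τ : ℝ) {W : Config m d (EuclideanSpace ℝ d)}
    {i j : Fin m} (hmem : (i, j) ∈ contactPairs ε W) :
    liftedWeight ε β₀ τ m (collidePair (Euclidean.geometry d) i j W) = liftedWeight ε β₀ τ m W := by
  have hij : i ≠ j := (mem_contactPairs.1 hmem).1.ne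
  by_cases hcard : (contactPairs ε W).card ≤ 1
  · -- the contact pairs of both configurations are `{(i, j)}`
    have hsing : contactPairs ε W = {(i, j)} :=
      Finset.eq_singleton_iff_unique_mem.2 ⟨hmem, fun p hp => Finset.card_le_one.1 hcard p hp _ hmem⟩
    have hcard' : (contactPairs ε (collidePair (Euclidean.geometry d) i j W)).card ≤ 1 := by
      rwa [contactPairs_collidePair]
    rw [liftedWeight_of_card_le_one β₀ τ hcard, liftedWeight_of_card_le_one β₀ τ hcard']
    congr 2
    unfold liftedMoment
    rw [contactPairs_collidePair, hsing, Finset.fold_singleton, Finset.fold_singleton,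
      collidePair_collidePair hij, max_comm]
  · have h2 : 2 ≤ (contactPairs ε W).card := by omega
    have h2' : 2 ≤ (contactPairs ε (collidePair (Euclidean.geometry d) i j W)).card := by
      rwa [contactPairs_collidePair]
    rw [liftedWeight_of_two_le β₀ τ h2, liftedWeight_of_two_le β₀ τ h2']

end Weight

/-! ## §2. Trajectories: at most one contact pair, and dispersion from the left limit -/

section Trajectory

variable {m : ℕ} {ε : ℝ}

/-- The Euclidean translations are continuous. [folklore] -/
theorem continuous_euclidean_translate (x : EuclideanSpace ℝ d) :
    Continuous ((Euclidean.geometry d).translate x) :=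
  (continuous_const.add continuous_id : Continuous fun v : EuclideanSpace ℝ d => x + v)

/-- A contact pair of a configuration of the hard-sphere domain is a pair in contact in the sense
of `contactSet`. [folklore] -/
theorem mem_contactSet_of_mem_contactPairs {W : Config m d (EuclideanSpace ℝ d)}
    (hW : W ∈ hardSphereDomain (Euclidean.geometry d) m ε) {p : Fin m × Fin m}
    (hp : p ∈ contactPairs ε W) : W ∈ contactSet (Euclidean.geometry d) m ε p.1 p.2 :=
  ⟨hW, by rw [Euclidean.geometry_sepVec]; exact (mem_contactPairs.1 hp).2⟩

/-- **Collisions are binary: a value of a hard-sphere trajectory has at most one contact pair**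
(CIP 1994 §4.2, the good set avoids multiple collisions; here: the `binary` clause of
`IsHardSphereTrajectory`). [cite: CIP1994, §4.2 Thm 4.2.1] -/
theorem _root_.Literature.Analysis.FluidPDE.IsHardSphereTrajectory.card_contactPairs_le_one
    {γ : ℝ → Config m d (EuclideanSpace ℝ d)}
    (h : IsHardSphereTrajectory (Euclidean.geometry d) ε m γ) (t : ℝ) :
    (contactPairs ε (γ t)).card ≤ 1 := by
  by_contra hlt
  rw [not_le, Finset.one_lt_card] at hlt
  obtain ⟨p, hp, q, hq, hpq⟩ := hlt
  have hp' := mem_contactPairs.1 hp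
  have hq' := mem_contactPairs.1 hq
  have hcp := mem_contactSet_of_mem_contactPairs (h.mem t) hp
  have hcq := mem_contactSet_of_mem_contactPairs (h.mem t) hq
  have hbin := (h.binary t p.1 p.2 hp'.1.ne hcp).1 q.1 q.2 hq'.1.ne hcq
  -- `{q.1, q.2} = {p.1, p.2}` with both pairs increasing forces `q = p`
  have h1 : q.1 = p.1 ∨ q.1 = p.2 := by
    have : q.1 ∈ ({p.1, p.2} : Finset (Fin m)) := hbin ▸ Finset.mem_insert_self _ _
    simpa using this
  have h2 : q.2 = p.1 ∨ q.2 = p.2 := by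
    have : q.2 ∈ ({p.1, p.2} : Finset (Fin m)) := hbin ▸ Finset.mem_insert_of_mem (Finset.mem_singleton_self _)
    simpa using this
  have hp1 : p.1 = q.1 ∨ p.1 = q.2 := by
    have : p.1 ∈ ({q.1, q.2} : Finset (Fin m)) := hbin.symm ▸ Finset.mem_insert_self _ _
    simpa using this
  rcases h1 with h1 | h1 <;> rcases h2 with h2 | h2
  · exact absurd (h1.trans h2.symm) hq'.1.ne
  · exact hpq (Prod.ext h1.symm h2.symm)
  · have : q.1 < q.2 := hq'.1
    rw [h1, h2] at this
    exact absurd (hp'.1.trans this) (lt_irrefl _)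
  · rcases hp1 with hp1 | hp1
    · rw [h1] at hp1; exact absurd hp1 hp'.1.ne
    · rw [h2] at hp1; exact absurd hp1 hp'.1.ne

/-- A good configuration of a hard-sphere flow has at most one contact pair (it is the initial
value of its orbit). [folklore] -/
theorem _root_.Literature.Analysis.FluidPDE.HardSphereFlow.card_contactPairs_le_one_of_mem_good
    (Φ : HardSphereFlow (Euclidean.geometry d) ε m) {W : Config m d (EuclideanSpace ℝ d)}
    (hW : W ∈ Φ.good) : (contactPairs ε W).card ≤ 1 := by
  have h := (Φ.isTrajectory W hW).card_contactPairs_le_one 0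
  rwa [Φ.flow_zero W hW] at h

/-- **The dispersion inequality from the left limit** (CIP 1994 Lemma 4.2.4 read up to a collision
instant): along a hard-sphere trajectory in `ℝ^d`, for `0 ≤ τ < t`,
`∑_k |x_k(γ(t⁻)) - t v_k(γ(t⁻))|² ≤ ∑_k |x_k(γ τ) - τ v_k(γ τ)|²` — the backward-free-flight moment of
the LEFT limit at `t` (the pre-collisional configuration if `t` is a collision time) is also
dominated. Proof: `(u, t)` is collision-free for some `u ∈ [τ, t)`, the left limit is the free
flight of `γ u`, which does not change `I`, and Lemma 4.2.4 applies on `[τ, u]`.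
[cite: CIP1994, §4.2 Lemma 4.2.4] -/
theorem _root_.Literature.Analysis.FluidPDE.IsHardSphereTrajectory.bffMoment_leftLim_le
    {γ : ℝ → Config m d (EuclideanSpace ℝ d)}
    (h : IsHardSphereTrajectory (Euclidean.geometry d) ε m γ) {τ t : ℝ} (hτ : 0 ≤ τ) (hτt : τ < t) :
    bffMoment t (Function.leftLim γ t) ≤ bffMoment τ (γ τ) := by
  obtain ⟨s, hst, hfree⟩ := h.exists_Ioo_left_free t
  set u : ℝ := max s τ with hu
  have hut : u < t := max_lt hst hτt
  have hfree' : ∀ σ ∈ Ioo u t, σ ∉ collisionTimes (Euclidean.geometry d) ε γ := fun σ hσ =>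
    hfree σ ⟨(le_max_left _ _).trans_lt hσ.1, hσ.2⟩
  rw [h.leftLim_eq_freeFlight continuous_euclidean_translate hut hfree', bffMoment_freeFlight,
    sub_sub_cancel]
  exact h.sum_norm_sq_sub_smul_le_of_le hτ (le_max_right s τ)

end Trajectory

/-! ## §3. The lifted good-set transport carries the lifted weight -/

section Transport

variable {m : ℕ} {ε : ℝ}

/-- The core estimate at a good configuration: if `|g(Y)| ≤ K D_τ(Y) e^{-b E(Y)}` at every `Y`
with at most one contact pair, then for `W₀` good and `0 ≤ τ ≤ t`,
`|g(Φ_{-(t-τ)} W₀)| ≤ K D_t(W₀) e^{-b E(W₀)}` — Lemma 4.2.4 along the orbit through `W₀`, from its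
value (`sum_norm_sq_sub_smul_le_of_le`) and, if `W₀` is a contact configuration, from its left
limit `collidePair W₀` (`bffMoment_leftLim_le`, `eq_collidePair_leftLim`).
[cite: CIP1994, §4.5 (5.3)] -/
theorem _root_.Literature.Analysis.FluidPDE.HardSphereFlow.abs_apply_flow_le_liftedWeight
    (Φ : HardSphereFlow (Euclidean.geometry d) ε m) {b β₀ τ t K : ℝ} (hβ₀ : 0 ≤ β₀)
    (hτ : 0 ≤ τ) (hτt : τ ≤ t) (hK : 0 ≤ K) {g : Config m d (EuclideanSpace ℝ d) → ℝ}
    (hg : ∀ Y, (contactPairs ε Y).card ≤ 1 →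
      |g Y| ≤ K * (liftedWeight ε β₀ τ m Y * exp (-b * configEnergy Y)))
    {W₀ : Config m d (EuclideanSpace ℝ d)} (hW₀ : W₀ ∈ Φ.good) :
    |g (Φ.flow (-(t - τ)) W₀)| ≤ K * (liftedWeight ε β₀ t m W₀ * exp (-b * configEnergy W₀)) := by
  have hcard := Φ.card_contactPairs_le_one_of_mem_good hW₀
  rcases hτt.eq_or_lt with rfl | hlt
  · -- `τ = t`: no transport
    rw [sub_self, neg_zero, Φ.flow_zero W₀ hW₀]
    exact hg W₀ hcard
  -- the orbit through `Φ_{-t} W₀`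
  set γ : ℝ → Config m d (EuclideanSpace ℝ d) := fun a => Φ.flow a (Φ.flow (-t) W₀) with hγ
  have hgood : Φ.flow (-t) W₀ ∈ Φ.good := Φ.mapsTo_good (-t) hW₀
  have htraj : IsHardSphereTrajectory (Euclidean.geometry d) ε m γ := Φ.isTrajectory _ hgood
  have hγτ : γ τ = Φ.flow (-(t - τ)) W₀ := Φ.flow_flow_neg_eq hW₀ τ t
  have hγt : γ t = W₀ := by
    have h := Φ.flow_flow_neg_eq hW₀ t t
    rw [sub_self, neg_zero, Φ.flow_zero W₀ hW₀] at h
    exact h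
  -- the value at `γ τ`, a trajectory value
  have hY := hg (γ τ) (htraj.card_contactPairs_le_one τ)
  rw [← hγτ]
  refine hY.trans ?_
  have hE : configEnergy (γ τ) = configEnergy W₀ := by
    have h := IsHardSphereTrajectory.configEnergy_eq_holds htraj τ t
    rwa [hγt] at h
  rw [hE, liftedWeight_of_card_le_one β₀ t hcard]
  refine mul_le_mul_of_nonneg_left (mul_le_mul_of_nonneg_right ?_ (exp_pos _).le) hK
  refine (liftedWeight_le_exp hβ₀ τ m (γ τ)).trans (exp_le_exp.2 ?_)
  refine mul_le_mul_of_nonpos_left ?_ (by linarith)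
  -- `liftedMoment ε t W₀ ≤ bffMoment τ (γ τ)`: the value and the left limit
  refine liftedMoment_le_iff.2 ⟨?_, fun p hp => ?_⟩
  · have hdisp := htraj.sum_norm_sq_sub_smul_le_of_le hτ hτt
    rw [hγt] at hdisp
    exact hdisp
  · have hij : p.1 ≠ p.2 := (mem_contactPairs.1 hp).1.ne
    have hc : γ t ∈ contactSet (Euclidean.geometry d) m ε p.1 p.2 := by
      rw [hγt]
      exact mem_contactSet_of_mem_contactPairs (Φ.good_subset hW₀) hp
    have hleft := (htraj.eq_collidePair_leftLim hij hc).2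
    have hll : Function.leftLim γ t = collidePair (Euclidean.geometry d) p.1 p.2 W₀ := by
      rw [← hγt, hleft, collidePair_collidePair hij]
    have h := htraj.bffMoment_leftLim_le hτ hlt
    rwa [hll] at h

/-- **`htr` for the lifted good-set transport of hard spheres on `ℝ^d`** (CIP 1994 §4.5
(5.2)–(5.3) with Lemma 4.2.4, at every configuration including the pre-collisional ones where the
collision operator reads it): for a hard-sphere flow `Φ` on `m` particles, `0 ≤ τ ≤ t`, `K ≥ 0`,
`β₀ ≥ 0`, if `|g(Y)| ≤ K D_τ(Y) e^{-b E(Y)}` at every `Y` with at most one contact pair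
(`D = liftedWeight ε β₀`), then the canonical boundary version of the good-set transport satisfies
`|boundaryLift G ε m (1_{good} · g ∘ Φ_{-(t-τ)}) (Z)| ≤ K D_t(Z) e^{-b E(Z)}` at every `Z`: off the
good set and off the incoming contact configurations with good partner the left side vanishes;
at a good `Z` this is `abs_apply_flow_le_liftedWeight`; at an incoming contact configuration `Z`
of a pair `(i, m)` it is the same estimate at the outgoing partner `Z' = collidePair Z`, whose
lifted weight equals that of `Z` (`liftedWeight_collidePair_of_mem`).
[cite: CIP1994, §4.5 (5.2)–(5.3)] -/
theorem abs_boundaryLift_indicator_hsTransport_le_liftedWeight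
    (Φ : HardSphereFlow (Euclidean.geometry d) ε m) {b β₀ τ t K : ℝ} (hβ₀ : 0 ≤ β₀)
    (hτ : 0 ≤ τ) (hτt : τ ≤ t) (hK : 0 ≤ K) {g : Config m d (EuclideanSpace ℝ d) → ℝ}
    (hg : ∀ Y, (contactPairs ε Y).card ≤ 1 →
      |g Y| ≤ K * (liftedWeight ε β₀ τ m Y * exp (-b * configEnergy Y)))
    (Z : Config m d (EuclideanSpace ℝ d)) :
    |boundaryLift (Euclidean.geometry d) ε m (Φ.good.indicator (hsTransport Φ (t - τ) g)) Z| ≤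
      K * (liftedWeight ε β₀ t m Z * exp (-b * configEnergy Z)) := by
  have hRHS : ∀ W : Config m d (EuclideanSpace ℝ d),
      0 ≤ K * (liftedWeight ε β₀ t m W * exp (-b * configEnergy W)) := fun W =>
    mul_nonneg hK (mul_nonneg (liftedWeight_nonneg _ _ _ _ _) (exp_pos _).le)
  -- the un-lifted good-set transport at any configuration
  have hplain : ∀ W : Config m d (EuclideanSpace ℝ d),
      |Φ.good.indicator (hsTransport Φ (t - τ) g) W| ≤
        K * (liftedWeight ε β₀ t m W * exp (-b * configEnergy W)) := by
    intro W
    by_cases hW : W ∈ Φ.good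
    · rw [indicator_of_mem hW, hsTransport_apply]
      exact Φ.abs_apply_flow_le_liftedWeight hβ₀ hτ hτt hK hg hW
    · rw [indicator_of_notMem hW, abs_zero]
      exact hRHS W
  cases m with
  | zero => exact hplain Z
  | succ k =>
    -- at an incoming contact configuration of a pair `(i, k+1)` the lift reads the outgoing
    -- partner, whose energy and lifted weight are those of `Z`
    have hpartner : ∀ i : Fin k,
        ‖(Euclidean.geometry d).sepVec (Z (Fin.castSucc i)).1 (Z (Fin.last k)).1‖ = ε ∧
          IsIncoming (Euclidean.geometry d) Z (Fin.castSucc i) (Fin.last k) →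
        |Φ.good.indicator (hsTransport Φ (t - τ) g)
            (collidePair (Euclidean.geometry d) (Fin.castSucc i) (Fin.last k) Z)| ≤
          K * (liftedWeight ε β₀ t (k + 1) Z * exp (-b * configEnergy Z)) := by
      intro i hi
      have hmem : (Fin.castSucc i, Fin.last k) ∈ contactPairs ε Z :=
        mem_contactPairs.2 ⟨Fin.castSucc_lt_last i, by
          simpa only [Euclidean.geometry_sepVec] using hi.1⟩
      have hne : Fin.castSucc i ≠ Fin.last k := (Fin.castSucc_lt_last i).ne
      refine (hplain _).trans (le_of_eq ?_)
      rw [configEnergy_collidePair hne, liftedWeight_collidePair_of_mem β₀ t hmem]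
    classical
    rw [boundaryLift_succ]
    unfold incomingLift
    split_ifs with h
    · exact hpartner _ (Fin.find_spec h)
    · exact hplain Z

/-- `htr` for the lifted good-set transport, input in lifted form at every configuration — the
hypothesis `htr` of `abs_duhamelChain_le_dispersive_of_le` for the transports
`(m, t, g) ↦ boundaryLift G ε m (1_{good} · hsTransport (Φ m) t g)` and the weights
`Dsp τ m = liftedWeight ε β₀ τ m`. [cite: CIP1994, §4.5 (5.2)–(5.3)] -/
theorem abs_boundaryLift_indicator_hsTransport_le_liftedWeight_of_liftedWeight
    (Φ : HardSphereFlow (Euclidean.geometry d) ε m) {b β₀ τ t K : ℝ} (hβ₀ : 0 ≤ β₀)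
    (hτ : 0 ≤ τ) (hτt : τ ≤ t) (hK : 0 ≤ K) {g : Config m d (EuclideanSpace ℝ d) → ℝ}
    (hg : ∀ Y, |g Y| ≤ K * (liftedWeight ε β₀ τ m Y * exp (-b * configEnergy Y)))
    (Z : Config m d (EuclideanSpace ℝ d)) :
    |boundaryLift (Euclidean.geometry d) ε m (Φ.good.indicator (hsTransport Φ (t - τ) g)) Z| ≤
      K * (liftedWeight ε β₀ t m Z * exp (-b * configEnergy Z)) :=
  abs_boundaryLift_indicator_hsTransport_le_liftedWeight Φ hβ₀ hτ hτt hK (fun Y _ => hg Y) Z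

/-- The initial slot: the lifted good-set transport of a datum with the plain position Gaussian
`|g(Y)| ≤ K e^{-β₀ ∑|x_k|²} e^{-b E(Y)}` (CIP 1994 Thm 4.5.1 hypothesis ii); the rescaled
correlation functions of the grand-canonical rare-cloud data,
`abs_correlationFn_gcInitial_le_dispersive`) obeys the lifted bound at time `t ≥ 0`:
`|boundaryLift G ε m (1_{good} · g ∘ Φ_{-t}) (Z)| ≤ K D_t(Z) e^{-b E(Z)}` — at `τ = 0` the lifted
weight of a configuration with at most one contact pair IS the position Gaussian
(`liftedWeight_zero_of_card_le_one`: positions do not jump at collisions).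
[cite: CIP1994, §4.5 (5.3)] -/
theorem abs_boundaryLift_indicator_hsTransport_le_liftedWeight_of_sq_norm
    (Φ : HardSphereFlow (Euclidean.geometry d) ε m) {b β₀ t K : ℝ} (hβ₀ : 0 ≤ β₀)
    (ht : 0 ≤ t) (hK : 0 ≤ K) {g : Config m d (EuclideanSpace ℝ d) → ℝ}
    (hg : ∀ Y, |g Y| ≤ K * (exp (-β₀ * ∑ k, ‖(Y k).1‖ ^ 2) * exp (-b * configEnergy Y)))
    (Z : Config m d (EuclideanSpace ℝ d)) :
    |boundaryLift (Euclidean.geometry d) ε m (Φ.good.indicator (hsTransport Φ t g)) Z| ≤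
      K * (liftedWeight ε β₀ t m Z * exp (-b * configEnergy Z)) := by
  have h := abs_boundaryLift_indicator_hsTransport_le_liftedWeight Φ hβ₀ le_rfl ht hK (τ := 0)
    (fun Y hY => by rw [liftedWeight_zero_of_card_le_one β₀ hY]; exact hg Y) Z
  rwa [sub_zero] at h

end Transport

end

end Literature.MathematicalPhysics.KineticTheory
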